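import Mathlib

/-!
# Crux `ExactCertificate` (stmt-AtomisticToContinuum-11959), line `closure-makes-nogap-exact`,
# skeleton VIII (`InvisibilityDichotomy`): stub `stub_oneDimKernel`

Support file for the crux `ThreeConeCertificate.ExactCertificate`, skeleton VIII
(`Cruxes.ExactCertificate.Invisibility`).  Skeleton VIII is a dichotomy: in `d = 3` no nonzero
finite-range continuous radial kernel is "invisible" to a lattice (its field
`Σ_{y ∈ lattice} α (dist w y)` cannot vanish identically), whereas in `d = 1` such kernels EXIST.
This file proves the `d = 1` existence half: for every spacing `a > 0` there is a continuous
`α : ℝ → ℝ` with `α 0 ≠ 0`, vanishing on `[3a/2, ∞)`, whose lattice field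
`w ↦ Σ_{n ∈ ℤ} α |w - n a|` vanishes identically.

Construction: with the tent `T x = max 0 (1 - |x| / a)` (support `[-a, a]`, `T 0 = 1`) put
`α x = T x - (T (x - a/2) + T (x + a/2)) / 2`.  The translated tents `T (· - n a)`, `n ∈ ℤ`, form
a partition of unity on `ℝ` (`Σ_n T (x - n a) = 1`: only `n = m := ⌊x/a⌋` and `n = m + 1`
contribute, with values `1 - t` and `t`, `t = x/a - m ∈ [0, 1)`), so
`Σ_n α (w - n a) = 1 - (1 + 1)/2 = 0`; `α` is even, so `α |w - n a| = α (w - n a)`;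
`α 0 = 1 - (1/2 + 1/2)/2 = 1/2 ≠ 0`; and `α` vanishes on `[3a/2, ∞)` since all three tents do.
The tent `T` and the kernel `α` are not introduced as definitions: the helper lemmas take abstract
functions `T, K : ℝ → ℝ` together with their defining equations as hypotheses.
Pure Mathlib (`hasSum_sum_of_ne_finset_zero`, `Finset.sum_pair`, `Int.floor_le`,
`Int.lt_floor_add_one`, `HasSum.add/sub/div_const`); private helper lemmas only, no named facts.
All `[folklore]`.
-/

noncomputable section

namespace Summit.AtomisticToContinuum.Crystallization.Theorems.ThreeConeCertificateExactCertificate.Invisibility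

variable {a : ℝ} {T K : ℝ → ℝ}

/-- The tent `T x = max 0 (1 - |x| / a)` is continuous. [folklore] -/
private theorem tent_continuous (hT : ∀ x, T x = max 0 (1 - |x| / a)) : Continuous T := by
  rw [show T = fun x => max 0 (1 - |x| / a) from funext hT]
  fun_prop

/-- The tent `T x = max 0 (1 - |x| / a)` is even. [folklore] -/
private theorem tent_neg (hT : ∀ x, T x = max 0 (1 - |x| / a)) (x : ℝ) : T (-x) = T x := by
  rw [hT, hT, abs_neg]

/-- Outside the open interval `(-a, a)` the tent `T x = max 0 (1 - |x| / a)` vanishes.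
[folklore] -/
private theorem tent_eq_zero (hT : ∀ x, T x = max 0 (1 - |x| / a)) (ha : 0 < a) {x : ℝ}
    (hx : a ≤ |x|) : T x = 0 := by
  rw [hT]
  apply max_eq_left
  rw [sub_nonpos, le_div_iff₀ ha, one_mul]
  exact hx

/-- On `[-a, a]` the tent `T x = max 0 (1 - |x| / a)` equals `1 - |x| / a`. [folklore] -/
private theorem tent_eq_of_abs_le (hT : ∀ x, T x = max 0 (1 - |x| / a)) (ha : 0 < a) {x : ℝ}
    (hx : |x| ≤ a) : T x = 1 - |x| / a := by
  rw [hT]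
  apply max_eq_right
  rw [sub_nonneg, div_le_one ha]
  exact hx

/-- The integer translates of the tent `T x = max 0 (1 - |x| / a)` tile the line:
`Σ_{n ∈ ℤ} T (x - n a) = 1`; only the two indices `⌊x/a⌋, ⌊x/a⌋ + 1` contribute. [folklore] -/
private theorem hasSum_tent (hT : ∀ x, T x = max 0 (1 - |x| / a)) (ha : 0 < a) (x : ℝ) :
    HasSum (fun n : ℤ => T (x - n * a)) 1 := by
  set m : ℤ := ⌊x / a⌋
  have h1 : (m : ℝ) ≤ x / a := Int.floor_le _
  have h2 : x / a < m + 1 := Int.lt_floor_add_one _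
  rw [le_div_iff₀ ha] at h1
  rw [div_lt_iff₀ ha] at h2
  have hne : m ≠ m + 1 := by omega
  -- all tents other than the two nearest ones vanish at `x`
  have hzero : ∀ n ∉ ({m, m + 1} : Finset ℤ), T (x - n * a) = 0 := by
    intro n hn
    simp only [Finset.mem_insert, Finset.mem_singleton, not_or] at hn
    apply tent_eq_zero hT ha
    rcases lt_or_gt_of_ne hn.1 with h | h
    · have h' : (n : ℝ) ≤ m - 1 := by exact_mod_cast Int.le_sub_one_iff.mpr h
      have h'' : (n : ℝ) * a ≤ (m - 1) * a := mul_le_mul_of_nonneg_right h' ha.le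
      rw [abs_of_nonneg (by linarith)]
      linarith
    · have h' : (m : ℝ) + 2 ≤ n := by
        have : m + 2 ≤ n := by omega
        exact_mod_cast this
      have h'' : ((m : ℝ) + 2) * a ≤ n * a := mul_le_mul_of_nonneg_right h' ha.le
      rw [abs_of_neg (by linarith)]
      linarith
  have hsum : HasSum (fun n : ℤ => T (x - n * a)) (∑ n ∈ ({m, m + 1} : Finset ℤ), T (x - n * a)) :=
    hasSum_sum_of_ne_finset_zero hzero
  rw [Finset.sum_pair hne] at hsum
  -- the two nearest tents take the values `1 - t` and `t`
  have hA : 0 ≤ x - m * a := by linarith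
  have hB : x - ((m + 1 : ℤ) : ℝ) * a ≤ 0 := by push_cast; linarith
  rw [tent_eq_of_abs_le hT ha (by rw [abs_of_nonneg hA]; linarith), abs_of_nonneg hA,
    tent_eq_of_abs_le hT ha (by rw [abs_of_nonpos hB]; push_cast; linarith),
    abs_of_nonpos hB] at hsum
  convert hsum using 1
  push_cast
  field_simp
  ring

/-- The kernel `K x = T x - (T (x - a/2) + T (x + a/2)) / 2` of an even `T` is even. [folklore] -/
private theorem kernel_neg (hT : ∀ x, T x = max 0 (1 - |x| / a))
    (hK : ∀ x, K x = T x - (T (x - a / 2) + T (x + a / 2)) / 2) (x : ℝ) : K (-x) = K x := by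
  rw [hK, hK, show -x - a / 2 = -(x + a / 2) by ring, show -x + a / 2 = -(x - a / 2) by ring,
    tent_neg hT, tent_neg hT, tent_neg hT]
  ring

/-- The kernel `K x = T x - (T (x - a/2) + T (x + a/2)) / 2` is a function of `|x|`. [folklore] -/
private theorem kernel_abs (hT : ∀ x, T x = max 0 (1 - |x| / a))
    (hK : ∀ x, K x = T x - (T (x - a / 2) + T (x + a / 2)) / 2) (x : ℝ) : K |x| = K x := by
  rcases abs_choice x with h | h
  · rw [h]
  · rw [h, kernel_neg hT hK]

/-- The lattice field of the kernel `K x = T x - (T (x - a/2) + T (x + a/2)) / 2` vanishes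
identically: `Σ_{n ∈ ℤ} K (w - n a) = 0`, from the partition of unity `Σ_n T (· - n a) = 1`
applied at `w`, `w - a/2`, `w + a/2`. [folklore] -/
private theorem hasSum_kernel (hT : ∀ x, T x = max 0 (1 - |x| / a))
    (hK : ∀ x, K x = T x - (T (x - a / 2) + T (x + a / 2)) / 2) (ha : 0 < a) (w : ℝ) :
    HasSum (fun n : ℤ => K (w - n * a)) 0 := by
  have h0 := hasSum_tent hT ha w
  have h1 := hasSum_tent hT ha (w - a / 2)
  have h2 := hasSum_tent hT ha (w + a / 2)
  have key : (fun n : ℤ => K (w - n * a)) = fun n : ℤ =>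
      T (w - n * a) - (T (w - a / 2 - n * a) + T (w + a / 2 - n * a)) / 2 := by
    funext n
    rw [hK]
    ring_nf
  have h := h0.sub ((h1.add h2).div_const 2)
  rw [show (1 : ℝ) - (1 + 1) / 2 = 0 by norm_num] at h
  rw [key]
  exact h

/-- **Stub `stub_oneDimKernel`** (the `d = 1` half of the invisibility dichotomy).  For every
spacing `a > 0` there is a continuous finite-range even kernel `α` with `α 0 ≠ 0` whose lattice
field `w ↦ Σ_{n ∈ ℤ} α |w - n a|` vanishes identically on `ℝ`: take
`α = T - (T (· - a/2) + T (· + a/2)) / 2` with the tent `T x = max 0 (1 - |x| / a)` and range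
`L = 3a/2`. [folklore] -/
theorem stub_oneDimKernel : ∀ a : ℝ, 0 < a → ∃ (α : ℝ → ℝ) (L : ℝ), Continuous α ∧ α 0 ≠ 0 ∧
    (∀ r : ℝ, L ≤ r → α r = 0) ∧ ∀ w : ℝ, HasSum (fun n : ℤ => α |w - n * a|) 0 := by
  intro a ha
  -- the tent `T` and the kernel `K`, kept abstract through their defining equations
  obtain ⟨T, hT⟩ : ∃ T : ℝ → ℝ, ∀ x, T x = max 0 (1 - |x| / a) := ⟨_, fun _ => rfl⟩
  obtain ⟨K, hK⟩ : ∃ K : ℝ → ℝ, ∀ x, K x = T x - (T (x - a / 2) + T (x + a / 2)) / 2 :=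
    ⟨_, fun _ => rfl⟩
  refine ⟨K, 3 * a / 2, ?_, ?_, ?_, ?_⟩
  · -- continuity
    have hTc := tent_continuous hT
    rw [show K = fun x => T x - (T (x - a / 2) + T (x + a / 2)) / 2 from funext hK]
    fun_prop
  · -- `K 0 = 1/2 ≠ 0`
    have hhalf : |a / 2| ≤ a := by rw [abs_of_pos (by positivity)]; linarith
    have e0 : T 0 = 1 := by
      rw [hT, abs_zero, zero_div, sub_zero, max_eq_right zero_le_one]
    have e1 : T (0 - a / 2) = 1 / 2 := by
      rw [zero_sub, tent_neg hT, tent_eq_of_abs_le hT ha hhalf, abs_of_pos (by positivity)]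
      field_simp
      ring
    have e2 : T (0 + a / 2) = 1 / 2 := by
      rw [zero_add, tent_eq_of_abs_le hT ha hhalf, abs_of_pos (by positivity)]
      field_simp
      ring
    rw [hK, e0, e1, e2]
    norm_num
  · -- finite range `3a/2`
    intro r hr
    have hz : ∀ y : ℝ, a ≤ y → T y = 0 := fun y hy =>
      tent_eq_zero hT ha (by rwa [abs_of_nonneg (ha.le.trans hy)])
    rw [hK, hz r (by linarith), hz (r - a / 2) (by linarith), hz (r + a / 2) (by linarith)]
    norm_num
  · -- invisibility
    intro w
    simp only [kernel_abs hT hK]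
    exact hasSum_kernel hT hK ha w

end Summit.AtomisticToContinuum.Crystallization.Theorems.ThreeConeCertificateExactCertificate.Invisibility

end
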